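import Summits.AtomisticToContinuum.Crystallization.Theorems.OverbindingBudgetAffineFarFieldLedgerWindow
import Summits.AtomisticToContinuum.Crystallization.Theorems.OverbindingBudgetAffineFarFieldCollarStar
import Summits.AtomisticToContinuum.Crystallization.Theorems.OverbindingBudgetAffineFarFieldFrameRows

/-!
# Overbinding budget, affine far field — «LedgerShells»: the star, exclusion and sandwich rows READ OFF two shells

Support file for `Summit.AtomisticToContinuum.Crystallization.Theses.OverbindingBudget.RobustDefectLimitWindows`
(sub-problem (2c), leaf SW♭(30), part 27V «Voronoi-cell quadrature of the far field», instance 27Vc, density + ledger side).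
«LedgerWindow» `farField_ledger_of_rows` takes, per mover `u`, the rows (R-star) «every first-shell site `u'` (form 12) is
charted and its atom lies within `δ₀` of the chart prediction `ych u + A u (p u' − p u)`», (R-excl) «every OTHER atom of the
window is within `δ₀` of a first-shell prediction or at distance `≥ 2(a u)(1−σ)r₀` from `ych u`» and the two scalar sandwich
rows (R-in)/(R-out) at `(λ u, r₀ = ν/√2, a u)`.  A K-file cannot be asked to quantify over all atoms of the window, nor to
reason with `√2`.  This file DISCHARGES those four rows from data a K-file has by `norm_num` and finite lists — and is thereby
the satisfiability witness of the row bundle (critic r1806: every row-export node ships a must-inhabit item):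

* (S-chart) CHARTEDNESS of the two shells: `∀ u', form(u,u') ≤ 24 → u' ∈ Ach` (helper `charted_of_annulus`: it follows from
  an open annulus of charted sites about `q₀` containing the `√2ν`-ball about `p u`, all in reference positions);
* (S-1) FIRST-SHELL RESIDUALS `dist (ych u') (ych u + A u (p u' − p u)) ≤ δ₀` for the twelve `u'` of form `12`;
* (S-2) SECOND-SHELL RESIDUALS `… ≤ δ₂` for the six `u'` of form `24` (the same chart predicts the `√2ν`-contacts);
* (S-far) the mover is DEEP IN THE FAR FIELD: `ρ₀ + ρQ u + û ≤ dist (p u) q₀`, where every uncharted atom lies in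
  `closedBall q₀ ρ₀` («CollarWindow» (W-core) `hunc`) and the charted atoms are `û`-registered (`hreg`, as in the ledger);
* (S-num) ONE RATIONAL BLOCK per mover class: an exclusion surrogate `ρQ u ≥ 0` with `2((a u)(1−σ))²ν² ≤ (ρQ u)²`
  (so `2(a u)(1−σ)r₀ ≤ ρQ u`), a lower conformal constant `alow u ≥ 0` with `(alow u)² ≤ (1−m)(λ u)²` («FrameRows»
  `lower_norm_of_conformal`: `alow u·‖v‖ ≤ ‖A u v‖`), the second-shell margin `(ρQ u + δ₂)² ≤ 2ν²(alow u)²` and the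
  third-shell margin `3(ρQ u + 2û)² ≤ 8ν²`; and ONCE the sandwich rows (R-in)/(R-out) at a lower dilation `0 < lmin ≤ λ u`,
  an upper rational surrogate `r₁ ≥ r₀` (`ν² ≤ 2r₁²`) and the uniform norm bound `a` — monotonicity carries them to every
  mover (`inout_of_lmin`; the gap sign `σ(1−m) ≥ (1±σ)m` is forced by the rows themselves since `lmin > 0`).

THE LATTICE INPUT is the SHELL GAP ★ `thirtytwo_le_barlowSiteForm`: in every Barlow stacking two distinct sites have form
`12` (distance `ν`), `24` (`√2ν`) or `≥ 32` (`≥ √(8/3)ν`; hcp attains `32`, fcc jumps to `36`) — one `decide +kernel` over the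
complete relative box `barlowLocBox 1 4 2` (135 sites) × the sixteen local words («CollarStar» transport
`barlowSiteForm_eq_locForm`, completeness «CollarAtlas» `mem_barlowBox_of_form_le` at `K = 31`).  Exclusion then reads: a
charted atom `ych u''`, `u'' ≠ u`, is a first-shell atom (left disjunct, by (S-1)), a second-shell atom (distance
`≥ alow·√2ν − δ₂ ≥ ρQ`, by (S-2)), or farther (distance `≥ √(8/3)ν − 2û ≥ ρQ`, by registration); an uncharted atom is at
distance `≥ dist(p u, q₀) − ρ₀ − û ≥ ρQ` (by (S-far)).

NUMBERS (docstring level, ν = 1, m = 10⁻³, σ = 3·10⁻³, a u = 1.001, λ u ≥ lmin = 0.999, alow u = 0.9989): ρQ u = 1.4114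
(`2·(1.001·0.997)² = 1.99196 ≤ 1.99205`), second shell `(1.4114 + δ₂)² ≤ 1.99560` allows `δ₂ ≤ 1.2·10⁻³`, third shell
`3(1.4114 + 2û)² ≤ 8` allows `û ≤ 0.110`; (R-in)/(R-out) at `δ₀ = 10⁻⁴`, `r₁ = 0.70711`: `6.7·10⁻⁴ ≤ 1.49·10⁻³`.  The binding
constraint on `σ` is `(a u)(1−σ) < alow u − δ₂/√2`, i.e. `σ ≳ m + δ₂/(√2ν)` PER MOVER — the dilation spread of the far field
never enters (the point of the per-mover columns of «LedgerWindow»).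

★★ `farField_ledger_of_shells` = «LedgerWindow» `farField_ledger_of_rows` with (R-star)/(R-excl)/(R-in)/(R-out) replaced by
(S-chart)/(S-1)/(S-2)/(S-far)/(S-num); everything else (chart rows, registration, volume dial, the two tessellations, the kernel)
verbatim.  Types are spelled out (no local notation).

[this file; Conway–Sloane, Sphere Packings ch. 2, 21 (shell structure of the close packings)]
-/

namespace Summit.AtomisticToContinuum.Crystallization.Theorems.OverbindingBudgetAffineFarFieldLedgerShells

noncomputable section

open Set MeasureTheory Metric
open Literature.Geometry.DiscreteGeometry Literature.MathematicalPhysics.StatisticalMechanics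
open Literature.Barriers.AtomisticToContinuum (voronoiCell)
open Summit.AtomisticToContinuum.Crystallization.Theorems.OverbindingBudgetAffineFarFieldCellTaylor
open Summit.AtomisticToContinuum.Crystallization.Theorems.OverbindingBudgetAffineFarFieldCellAffine
open Summit.AtomisticToContinuum.Crystallization.Theorems.OverbindingBudgetAffineFarFieldCellMove
open Summit.AtomisticToContinuum.Crystallization.Theorems.OverbindingBudgetAffineFarFieldCellRD
open Summit.AtomisticToContinuum.Crystallization.Theorems.OverbindingBudgetAffineFarFieldCellTRD
open Summit.AtomisticToContinuum.Crystallization.Theorems.OverbindingBudgetAffineFarFieldCellLedgerIdeal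
open Summit.AtomisticToContinuum.Crystallization.Theorems.OverbindingBudgetAffineFarFieldCellVoronoiFeed
open Summit.AtomisticToContinuum.Crystallization.Theorems.OverbindingBudgetAffineFarFieldCollarSites
open Summit.AtomisticToContinuum.Crystallization.Theorems.OverbindingBudgetAffineFarFieldCollarAtlas
open Summit.AtomisticToContinuum.Crystallization.Theorems.OverbindingBudgetAffineFarFieldCollarStar
open Summit.AtomisticToContinuum.Crystallization.Theorems.OverbindingBudgetAffineFarFieldCollarWindow
open Summit.AtomisticToContinuum.Crystallization.Theorems.OverbindingBudgetAffineFarFieldFrameRows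
open Summit.AtomisticToContinuum.Crystallization.Theorems.OverbindingBudgetAffineFarFieldLedgerWindow

/-! ## §1 The shell gap of the close packings: form `12`, `24` or `≥ 32` -/

/-- ★ KERNEL (all sixteen local words): in the complete relative box for form `≤ 31` the local form about the base site is
`0`, `12`, `24` or `≥ 32`. [this file, `decide +kernel`] -/
theorem locKernel_shells : ∀ σ ∈ ({1, -1} : Finset ℤ), ∀ w ∈ haggWords σ, ∀ k ∈ barlowLocBox 1 4 2,
    locForm w (0, 0, 0) k ≤ 0 ∨ locForm w (0, 0, 0) k = 12 ∨ locForm w (0, 0, 0) k = 24 ∨ 32 ≤ locForm w (0, 0, 0) k := by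
  set_option maxRecDepth 200000 in decide +kernel

/-- ★ SHELL GAP: two distinct sites of a Barlow stacking at form neither `12` (distance `ν`) nor `24` (distance `√2ν`) have
form `≥ 32` (distance `≥ √(8/3)ν`). [this file: kernel + «CollarStar» transport + «CollarAtlas» box completeness] -/
theorem thirtytwo_le_barlowSiteForm {s : ℤ → ℤ} (hs : IsHaggSeq s) {u u' : ℤ × ℤ × ℤ} (hne : u ≠ u')
    (h12 : barlowSiteForm s u u' ≠ 12) (h24 : barlowSiteForm s u u' ≠ 24) : 32 ≤ barlowSiteForm s u u' := by
  by_contra hlt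
  rw [not_le] at hlt
  have hge := twelve_le_barlowSiteForm hs hne
  have hub : u' ∈ barlowBox u 1 4 2 := (mem_barlowBox_of_form_le (u := u') (u₀ := u) (K := 31) (Ll := 1) (La := 4)
    (Lb := 2) hs (by rw [barlowSiteForm_comm]; omega) (by norm_num) (by norm_num) (by norm_num) :)
  have hl := layer_sub_of_mem_barlowBox hub
  have e : barlowSiteForm s u u' = locForm (barlowWordAt s u.1) (0, 0, 0) (barlowRelIdx u u') := by
    rw [barlowSiteForm_eq_locForm s u u u' (by omega) (by omega), barlowRelIdx_self]
  have hub' : barlowRelIdx u u' ∈ barlowLocBox 1 4 2 :=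
    (barlowRelIdx_mem_barlowLocBox (k₁ := u) (u := u') (Ll := 1) (La := 4) (Lb := 2) hub :)
  have hw := barlowWordAt_mem hs u.1
  have hσ : s (u.1 - 2) ∈ ({1, -1} : Finset ℤ) := by
    rcases hs (u.1 - 2) with h | h <;> simp [h]
  rw [e] at hlt hge h12 h24
  rcases (locKernel_shells (s (u.1 - 2)) hσ (barlowWordAt s u.1) hw (barlowRelIdx u u') hub' :) with h | h | h | h
  · omega
  · exact h12 h
  · exact h24 h
  · omega

/-! ## §2 Chartedness of the two shells from an annulus of charted sites -/

/-- support (S-chart from an annulus): if every site with `ρ₁ < dist (p u') q₀ < ρ₂` is charted and the mover's site is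
`d`-inside that annulus with `d² ≥ 2ν²`, then every site of form `≤ 24` about it is charted. [«CollarSites»
`twelve_mul_dist_placedSite_sq`] -/
theorem charted_of_annulus {s : ℤ → ℤ} {ν : ℝ} (hν : 0 < ν) (q : EuclideanSpace ℝ (Fin 3))
    (R : EuclideanSpace ℝ (Fin 3) ≃ₗᵢ[ℝ] EuclideanSpace ℝ (Fin 3)) {Ach : Set (ℤ × ℤ × ℤ)}
    {q₀ : EuclideanSpace ℝ (Fin 3)} {ρ₁ ρ₂ d : ℝ}
    (hann : ∀ u', ρ₁ < dist (placedSite s ν q R u') q₀ → dist (placedSite s ν q R u') q₀ < ρ₂ → u' ∈ Ach)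
    (hd0 : 0 ≤ d) (hd : 2 * ν ^ 2 ≤ d ^ 2) {u : ℤ × ℤ × ℤ} (h1 : ρ₁ + d < dist (placedSite s ν q R u) q₀)
    (h2 : dist (placedSite s ν q R u) q₀ + d < ρ₂) :
    ∀ u', barlowSiteForm s u u' ≤ 24 → u' ∈ Ach := by
  intro u' hF
  have h12 := twelve_mul_dist_placedSite_sq (s := s) (q := q) (R := R) hν.le u u'
  have hF' : (barlowSiteForm s u u' : ℝ) ≤ 24 := by exact_mod_cast hF
  have hdd : dist (placedSite s ν q R u) (placedSite s ν q R u') ≤ d := by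
    have hsq : dist (placedSite s ν q R u) (placedSite s ν q R u') ^ 2 ≤ d ^ 2 := by
      nlinarith [mul_le_mul_of_nonneg_left hF' (sq_nonneg ν)]
    exact (abs_le_of_sq_le_sq' hsq hd0).2
  have ht := dist_triangle (placedSite s ν q R u) (placedSite s ν q R u') q₀
  have ht' := dist_triangle (placedSite s ν q R u') (placedSite s ν q R u) q₀
  rw [dist_comm (placedSite s ν q R u') (placedSite s ν q R u)] at ht'
  exact hann u' (by linarith) (by linarith)

/-! ## §3 The star row and the exclusion row of one mover, read off the two shells -/

/-- ★ support (ROWS FROM SHELLS, one mover): reference = placed close-packed sites, `r₀ = ν/√2`; charted atoms `ych` on `Ach`,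
`û`-registered; uncharted atoms `yunc` in `closedBall q₀ ρ₀`; a charted mover `u` with world chart `A` (conformal up to `m` at
dilation `λ`; its norm bound `av` enters only through `ρQ`).  From (S-chart), (S-1) at `δ₀`, (S-2) at `δ₂`, (S-far) and the
rational block (S-num) follow the two rows of «LedgerRows» `ledgerRows_of_star`: (R-star) and the guarded (R-excl) at radius
`2·av·(1−σ)r₀`. [this file] -/
theorem starRows_of_shells {μ : Type*} {s : ℤ → ℤ} (hs : IsHaggSeq s) {ν : ℝ} (hν : 0 < ν) (q : EuclideanSpace ℝ (Fin 3))
    (R : EuclideanSpace ℝ (Fin 3) ≃ₗᵢ[ℝ] EuclideanSpace ℝ (Fin 3)) (Ach : Set (ℤ × ℤ × ℤ))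
    (ych : ℤ × ℤ × ℤ → EuclideanSpace ℝ (Fin 3)) (yunc : μ → EuclideanSpace ℝ (Fin 3)) {r₀ û : ℝ}
    (hr₀ : r₀ = ν / Real.sqrt 2) (hreg : ∀ u ∈ Ach, dist (ych u) (placedSite s ν q R u) ≤ û)
    (q₀ : EuclideanSpace ℝ (Fin 3)) {ρ₀ : ℝ} (hunc : ∀ e, dist (yunc e) q₀ ≤ ρ₀)
    {u : ℤ × ℤ × ℤ} (hu : u ∈ Ach) (A : EuclideanSpace ℝ (Fin 3) ≃L[ℝ] EuclideanSpace ℝ (Fin 3))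
    {lam m av alow ρQ δ₀ δ₂ σ : ℝ}
    (hB : ∀ x x' : EuclideanSpace ℝ (Fin 3), |inner ℝ (A x) (A x') - lam ^ 2 * inner ℝ x x'| ≤ m * lam ^ 2 * ‖x‖ * ‖x'‖)
    (hch : ∀ u', barlowSiteForm s u u' ≤ 24 → u' ∈ Ach)
    (hres1 : ∀ u', barlowSiteForm s u u' = 12 →
      dist (ych u') (ych u + A (placedSite s ν q R u' - placedSite s ν q R u)) ≤ δ₀)
    (hres2 : ∀ u', barlowSiteForm s u u' = 24 →
      dist (ych u') (ych u + A (placedSite s ν q R u' - placedSite s ν q R u)) ≤ δ₂)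
    (hfar : ρ₀ + ρQ + û ≤ dist (placedSite s ν q R u) q₀)
    (hρQ0 : 0 ≤ ρQ) (hρQ : 2 * (av * (1 - σ)) ^ 2 * ν ^ 2 ≤ ρQ ^ 2) (hal0 : 0 ≤ alow)
    (hal : alow ^ 2 ≤ (1 - m) * lam ^ 2) (hsh2 : (ρQ + δ₂) ^ 2 ≤ 2 * ν ^ 2 * alow ^ 2)
    (hsh3 : 3 * (ρQ + 2 * û) ^ 2 ≤ 8 * ν ^ 2) :
    (∀ u', barlowSiteForm s u u' = 12 →
        u' ∈ Ach ∧ dist (ych u') (ych u + A (placedSite s ν q R u' - placedSite s ν q R u)) ≤ δ₀) ∧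
      ∀ z ∈ windowAtomSet Ach ych yunc, z ≠ ych u →
        (∃ u', barlowSiteForm s u u' = 12 ∧ dist z (ych u + A (placedSite s ν q R u' - placedSite s ν q R u)) ≤ δ₀) ∨
          2 * av * (1 - σ) * r₀ ≤ dist z (ych u) := by
  -- the exclusion radius is at most the rational surrogate `ρQ`
  have hr₀sq : r₀ ^ 2 = ν ^ 2 / 2 := by rw [hr₀, div_pow, Real.sq_sqrt zero_le_two]
  have hRρ : 2 * av * (1 - σ) * r₀ ≤ ρQ := by
    have h : (2 * av * (1 - σ) * r₀) ^ 2 ≤ ρQ ^ 2 := by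
      rw [show (2 * av * (1 - σ) * r₀) ^ 2 = 4 * (av * (1 - σ)) ^ 2 * r₀ ^ 2 by ring, hr₀sq]
      linarith
    exact (abs_le_of_sq_le_sq' h hρQ0).2
  refine ⟨fun u' h12 => ⟨hch u' (by omega), hres1 u' h12⟩, fun z hz hne => ?_⟩
  simp only [windowAtomSet, mem_union, mem_image, mem_range] at hz
  rcases hz with ⟨u'', hu'', rfl⟩ | ⟨e, rfl⟩
  · -- a charted atom `ych u''`, `u'' ≠ u`
    have hne' : u ≠ u'' := fun h => hne (by rw [h])
    by_cases h12 : barlowSiteForm s u u'' = 12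
    · exact Or.inl ⟨u'', h12, hres1 u'' h12⟩
    refine Or.inr (hRρ.trans ?_)
    have h12d := twelve_mul_dist_placedSite_sq (s := s) (q := q) (R := R) hν.le u'' u
    rw [barlowSiteForm_comm] at h12d
    by_cases h24 : barlowSiteForm s u u'' = 24
    · -- second shell: the chart predicts the atom at `‖A v‖ ≥ alow·√2ν` from `ych u`, up to `δ₂`
      have hv : ‖placedSite s ν q R u'' - placedSite s ν q R u‖ ^ 2 = 2 * ν ^ 2 := by
        rw [← dist_eq_norm]
        rw [h24] at h12d
        push_cast at h12d
        linarith
      have hlow := lower_norm_of_conformal (A : EuclideanSpace ℝ (Fin 3) →L[ℝ] EuclideanSpace ℝ (Fin 3)) hB hal0 hal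
        (placedSite s ν q R u'' - placedSite s ν q R u)
      simp only [ContinuousLinearEquiv.coe_coe] at hlow
      have hAv : ρQ + δ₂ ≤ alow * ‖placedSite s ν q R u'' - placedSite s ν q R u‖ := by
        have h2 : (ρQ + δ₂) ^ 2 ≤ (alow * ‖placedSite s ν q R u'' - placedSite s ν q R u‖) ^ 2 := by
          rw [mul_pow, hv]; linarith
        exact (abs_le_of_sq_le_sq' h2 (by positivity)).2
      have h1 : dist (ych u + A (placedSite s ν q R u'' - placedSite s ν q R u)) (ych u) =
          ‖A (placedSite s ν q R u'' - placedSite s ν q R u)‖ := by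
        rw [dist_eq_norm, add_sub_cancel_left]
      have h2 := dist_triangle (ych u + A (placedSite s ν q R u'' - placedSite s ν q R u)) (ych u'') (ych u)
      have h3 := hres2 u'' h24
      rw [dist_comm] at h3
      linarith
    · -- third shell or beyond: `dist (p u'') (p u) ≥ √(8/3)ν ≥ ρQ + 2û`, then registration at both ends
      have h32 := thirtytwo_le_barlowSiteForm hs hne' h12 h24
      have h32' : (32 : ℝ) ≤ (barlowSiteForm s u u'' : ℝ) := by exact_mod_cast h32
      have hd : ρQ + 2 * û ≤ dist (placedSite s ν q R u'') (placedSite s ν q R u) := by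
        have h2 : (ρQ + 2 * û) ^ 2 ≤ dist (placedSite s ν q R u'') (placedSite s ν q R u) ^ 2 := by
          nlinarith [mul_le_mul_of_nonneg_left h32' (sq_nonneg ν)]
        exact (abs_le_of_sq_le_sq' h2 dist_nonneg).2
      have h1 := hreg u'' hu''
      have h2 := hreg u hu
      have h3 := dist_triangle4 (placedSite s ν q R u'') (ych u'') (ych u) (placedSite s ν q R u)
      rw [dist_comm] at h1
      linarith
  · -- an uncharted atom lies in the core ball, the mover deep in the far field
    refine Or.inr (hRρ.trans ?_)
    have h1 := hunc e
    have h2 := hreg u hu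
    have h3 := dist_triangle4 (placedSite s ν q R u) (ych u) (yunc e) q₀
    rw [dist_comm] at h2
    rw [dist_comm]
    linarith

/-! ## §4 The two scalar sandwich rows from one rational block -/

/-- support (MONOTONE READER for (R-in)/(R-out)): the two sandwich rows of «LedgerRows» at `(λ, r₀ = ν/√2, av)` follow from
the same rows at a lower dilation `0 < lmin ≤ λ`, an upper surrogate `r₁ ≥ 0` with `ν² ≤ 2r₁²` and an upper norm bound
`a ≥ av ≥ 0` (`δ₀ ≥ 0`, `0 ≤ σ < 1`); the gap signs `σ(1−m) − (1∓σ)m ≥ 0` are forced by the rows at `lmin > 0`. [this file] -/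
theorem inout_of_lmin {ν r₀ r₁ lmin lam m a av δ₀ σ : ℝ} (hν : 0 < ν) (hr₀ : r₀ = ν / Real.sqrt 2) (hr₁ : 0 ≤ r₁)
    (hr₁' : ν ^ 2 ≤ 2 * r₁ ^ 2) (hδ₀ : 0 ≤ δ₀) (hσ0 : 0 ≤ σ) (hσ1 : σ < 1) (hav0 : 0 ≤ av) (hav : av ≤ a)
    (hlmin : 0 < lmin) (hl : lmin ≤ lam)
    (hin0 : (1 - σ) * m * lmin ^ 2 * ν ^ 2 / 2 + a * δ₀ * ((1 - σ) * r₁ + ν) ≤ σ * (1 - m) * lmin ^ 2 * ν ^ 2 / 2)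
    (hout0 : (1 + σ) * m * lmin ^ 2 * ν ^ 2 / 2 + a * δ₀ * ((1 + σ) * r₁ + ν) + δ₀ ^ 2 / 2 <
      σ * (1 - m) * lmin ^ 2 * ν ^ 2 / 2) :
    ((1 - σ) * m * lam ^ 2 * ν ^ 2 / 2 + av * δ₀ * ((1 - σ) * r₀ + ν) ≤ σ * (1 - m) * lam ^ 2 * ν ^ 2 / 2) ∧
      ((1 + σ) * m * lam ^ 2 * ν ^ 2 / 2 + av * δ₀ * ((1 + σ) * r₀ + ν) + δ₀ ^ 2 / 2 <
        σ * (1 - m) * lam ^ 2 * ν ^ 2 / 2) := by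
  have hr₀0 : 0 ≤ r₀ := by rw [hr₀]; positivity
  have hr₀1 : r₀ ≤ r₁ := by
    have h : r₀ ^ 2 ≤ r₁ ^ 2 := by rw [hr₀, div_pow, Real.sq_sqrt zero_le_two]; linarith
    exact (abs_le_of_sq_le_sq' h hr₁).2
  have ha0 : 0 ≤ a := hav0.trans hav
  have hL0 : 0 < lmin ^ 2 * ν ^ 2 / 2 := by positivity
  have hL : lmin ^ 2 * ν ^ 2 / 2 ≤ lam ^ 2 * ν ^ 2 / 2 := by
    have h := pow_le_pow_left₀ hlmin.le hl 2
    nlinarith [sq_nonneg ν]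
  have hF1 : av * δ₀ * ((1 - σ) * r₀ + ν) ≤ a * δ₀ * ((1 - σ) * r₁ + ν) :=
    mul_le_mul (mul_le_mul_of_nonneg_right hav hδ₀) (by nlinarith) (by nlinarith) (mul_nonneg ha0 hδ₀)
  have hF2 : av * δ₀ * ((1 + σ) * r₀ + ν) ≤ a * δ₀ * ((1 + σ) * r₁ + ν) :=
    mul_le_mul (mul_le_mul_of_nonneg_right hav hδ₀) (by nlinarith) (by nlinarith) (mul_nonneg ha0 hδ₀)
  have hF1n : 0 ≤ a * δ₀ * ((1 - σ) * r₁ + ν) := mul_nonneg (mul_nonneg ha0 hδ₀) (by nlinarith)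
  have hF2n : 0 ≤ a * δ₀ * ((1 + σ) * r₁ + ν) := mul_nonneg (mul_nonneg ha0 hδ₀) (by nlinarith)
  have hc : 0 ≤ σ * (1 - m) - (1 - σ) * m := by
    by_contra h
    rw [not_le] at h
    have h' := mul_neg_of_neg_of_pos h hL0
    linarith
  have hc' : 0 ≤ σ * (1 - m) - (1 + σ) * m := by
    by_contra h
    rw [not_le] at h
    have h' := mul_neg_of_neg_of_pos h hL0
    nlinarith [sq_nonneg δ₀]
  have h1 := mul_nonneg hc (sub_nonneg.2 hL)
  have h2 := mul_nonneg hc' (sub_nonneg.2 hL)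
  constructor
  · linarith
  · linarith

/-! ## §5 The far-field ledger for the reference tessellation, rows read off the shells -/

/-- ★★ support (THE FAR-FIELD LEDGER FROM SHELL DATA): «LedgerWindow» `farField_ledger_of_rows` with the per-mover rows
(R-star), (R-excl), (R-in), (R-out) DISCHARGED from (S-chart) chartedness of the two shells, (S-1)/(S-2) first- and second-shell
residuals at `δ₀`/`δ₂`, (S-far) depth in the far field (uncharted atoms in `closedBall q₀ ρ₀`), the rational block (S-num)
(`ρQ u`, `alow u`, two margins) and ONE pair of sandwich rows at `(lmin, r₁, a)`; registration, chart rows, the volume dial,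
the two tessellations and the kernel data verbatim; conclusion verbatim. [this file: «LedgerWindow» + §1–§4] -/
theorem farField_ledger_of_shells (hC : HasRadialMoments (rdCell 1) 16 24 (656 / 15))
    (hT : |∫ x in trdCell 1, x 0 * x 1 * x 2| ≤ 112 / 405)
    {μ : Type*} {s : ℤ → ℤ} (hs : IsHaggSeq s) {ν : ℝ} (hν : 0 < ν) (q : EuclideanSpace ℝ (Fin 3))
    (R : EuclideanSpace ℝ (Fin 3) ≃ₗᵢ[ℝ] EuclideanSpace ℝ (Fin 3)) (Ach : Set (ℤ × ℤ × ℤ))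
    (ych : ℤ × ℤ × ℤ → EuclideanSpace ℝ (Fin 3)) (yunc : μ → EuclideanSpace ℝ (Fin 3)) {r₀ û : ℝ}
    (hr₀ : r₀ = ν / Real.sqrt 2) (hû : 2 * û < ν) (hreg : ∀ u ∈ Ach, dist (ych u) (placedSite s ν q R u) ≤ û)
    (q₀ : EuclideanSpace ℝ (Fin 3)) {ρ₀ : ℝ} (hunc : ∀ e, dist (yunc e) q₀ ≤ ρ₀)
    (t uref : Finset (ℤ × ℤ × ℤ)) (ht : ∀ u ∈ t, u ∈ Ach)
    {A : ℤ × ℤ × ℤ → (EuclideanSpace ℝ (Fin 3) ≃L[ℝ] EuclideanSpace ℝ (Fin 3))} {lam av alow ρQ : ℤ × ℤ × ℤ → ℝ}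
    {θ m a δ₀ δ₂ σ θv lmin r₁ : ℝ}
    (hθ0 : 0 ≤ θ) (hm0 : 0 ≤ m) (hm1 : m ≤ 1) (hσ0 : 0 ≤ σ) (hσ1 : σ < 1) (hθv0 : 0 ≤ θv)
    (hθv : (1 + σ) ^ 3 ≤ (1 + θv) * (1 - σ) ^ 3) (hδ₀ : 0 ≤ δ₀)
    -- the chart rows, per mover (verbatim)
    (hθ : ∀ u ∈ t, ∀ x, ‖A u x - x‖ ≤ θ * ‖x‖)
    (hB : ∀ u ∈ t, ∀ x x' : EuclideanSpace ℝ (Fin 3),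
      |inner ℝ (A u x) (A u x') - lam u ^ 2 * inner ℝ x x'| ≤ m * lam u ^ 2 * ‖x‖ * ‖x'‖)
    (ha : ∀ u ∈ t, ‖(A u : EuclideanSpace ℝ (Fin 3) →L[ℝ] EuclideanSpace ℝ (Fin 3))‖ ≤ av u) (hav : ∀ u ∈ t, av u ≤ a)
    -- the shell data, per mover
    (hch : ∀ u ∈ t, ∀ u', barlowSiteForm s u u' ≤ 24 → u' ∈ Ach)
    (hres1 : ∀ u ∈ t, ∀ u', barlowSiteForm s u u' = 12 →
      dist (ych u') (ych u + A u (placedSite s ν q R u' - placedSite s ν q R u)) ≤ δ₀)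
    (hres2 : ∀ u ∈ t, ∀ u', barlowSiteForm s u u' = 24 →
      dist (ych u') (ych u + A u (placedSite s ν q R u' - placedSite s ν q R u)) ≤ δ₂)
    (hfar : ∀ u ∈ t, ρ₀ + ρQ u + û ≤ dist (placedSite s ν q R u) q₀)
    (hρQ : ∀ u ∈ t, 0 ≤ ρQ u ∧ 2 * (av u * (1 - σ)) ^ 2 * ν ^ 2 ≤ ρQ u ^ 2)
    (hal : ∀ u ∈ t, 0 ≤ alow u ∧ alow u ^ 2 ≤ (1 - m) * lam u ^ 2)
    (hsh2 : ∀ u ∈ t, (ρQ u + δ₂) ^ 2 ≤ 2 * ν ^ 2 * alow u ^ 2) (hsh3 : ∀ u ∈ t, 3 * (ρQ u + 2 * û) ^ 2 ≤ 8 * ν ^ 2)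
    -- the sandwich rows, once
    (hlmin : 0 < lmin) (hl : ∀ u ∈ t, lmin ≤ lam u) (hr₁ : 0 ≤ r₁) (hr₁' : ν ^ 2 ≤ 2 * r₁ ^ 2)
    (hin0 : (1 - σ) * m * lmin ^ 2 * ν ^ 2 / 2 + a * δ₀ * ((1 - σ) * r₁ + ν) ≤ σ * (1 - m) * lmin ^ 2 * ν ^ 2 / 2)
    (hout0 : (1 + σ) * m * lmin ^ 2 * ν ^ 2 / 2 + a * δ₀ * ((1 + σ) * r₁ + ν) + δ₀ ^ 2 / 2 <
      σ * (1 - m) * lmin ^ 2 * ν ^ 2 / 2)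
    -- the two tessellations of the window (verbatim)
    {Wr Uc₁ Uc₂ U : Set (EuclideanSpace ℝ (Fin 3))} {g : EuclideanSpace ℝ (Fin 3) → ℝ} {D₁ D₂ D₃ D₄ E₃ E₄ : ℤ × ℤ × ℤ → ℝ}
    (hd₁ : AEDisjoint volume (⋃ i ∈ t, voronoiCell (windowAtomSet Ach ych yunc) (ych i)) Uc₁)
    (hc₁ : NullMeasurableSet Uc₁ volume)
    (hcov₁ : ((⋃ i ∈ t, voronoiCell (windowAtomSet Ach ych yunc) (ych i)) ∪ Uc₁ : Set (EuclideanSpace ℝ (Fin 3)))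
      =ᵐ[volume] Wr)
    (hci₁ : IntegrableOn g Uc₁)
    (hd₂ : AEDisjoint volume (⋃ j ∈ uref, refCell s ν q R j) Uc₂) (hc₂ : NullMeasurableSet Uc₂ volume)
    (hcov₂ : ((⋃ j ∈ uref, refCell s ν q R j) ∪ Uc₂ : Set (EuclideanSpace ℝ (Fin 3))) =ᵐ[volume] Wr)
    (hci₂ : IntegrableOn g Uc₂)
    -- the kernel (verbatim)
    (hU : IsOpen U) (hKU : ∀ i ∈ t, voronoiCell (windowAtomSet Ach ych yunc) (ych i) ⊆ U)
    (hKrU : ∀ j ∈ uref, refCell s ν q R j ⊆ U) (hg : ContDiffOn ℝ 4 g U)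
    (h1 : ∀ i ∈ t, ‖fderiv ℝ g (ych i)‖ ≤ D₁ i) (h2 : ∀ i ∈ t, ‖iteratedFDeriv ℝ 2 g (ych i)‖ ≤ D₂ i)
    (h3 : ∀ i ∈ t, ‖iteratedFDeriv ℝ 3 g (ych i)‖ ≤ D₃ i)
    (h4 : ∀ i ∈ t, ∀ x ∈ voronoiCell (windowAtomSet Ach ych yunc) (ych i), ‖iteratedFDeriv ℝ 4 g x‖ ≤ D₄ i)
    (e3 : ∀ j ∈ uref, ‖iteratedFDeriv ℝ 3 g (placedSite s ν q R j)‖ ≤ E₃ j)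
    (e4 : ∀ j ∈ uref, ∀ x ∈ refCell s ν q R j, ‖iteratedFDeriv ℝ 4 g x‖ ≤ E₄ j) :
    |(∑ i ∈ t, (g (ych i) + ν ^ 2 / 16 / 2 * lap g (ych i)))
        - (∑ j ∈ uref, (g (placedSite s ν q R j) + ν ^ 2 / 16 / 2 * lap g (placedSite s ν q R j)))
        - (∑ i ∈ t, ((volume (voronoiCell (windowAtomSet Ach ych yunc) (ych i))).toReal⁻¹ - Real.sqrt 2 / ν ^ 3) *
            ∫ x in voronoiCell (windowAtomSet Ach ych yunc) (ych i), g x)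
        - Real.sqrt 2 / ν ^ 3 * ((∫ x in Uc₂, g x) - ∫ x in Uc₁, g x)|
      ≤ (∑ i ∈ t, (a * (ν * (1 + σ) / Real.sqrt 2) * θv * D₁ i
          + (3 * |(ν * (1 - σ)) ^ 2 / 16| * θ * (1 + a) + 3 * |(ν * (1 - σ)) ^ 2 / 16| * θv
              + 3 * |(ν * (1 - σ)) ^ 2 / 16 - ν ^ 2 / 16| + (a * (ν * (1 + σ) / Real.sqrt 2)) ^ 2 * θv) / 2 * D₂ i
          + (idealTau (decide (s (i.1 - 1) = s i.1)) (ν * (1 - σ)) * a ^ 3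
              + (a * (ν * (1 + σ) / Real.sqrt 2)) ^ 3 * θv) / 6 * D₃ i
          + (41 / 960 * (ν * (1 - σ)) ^ 4 * a ^ 4 + (a * (ν * (1 + σ) / Real.sqrt 2)) ^ 4 * θv) / 24 * D₄ i))
        + ∑ j ∈ uref, (idealTau (decide (s (j.1 - 1) = s j.1)) ν / 6 * E₃ j + 41 / 960 * ν ^ 4 / 24 * E₄ j) := by
  have hrows := fun u (hu : u ∈ t) => starRows_of_shells hs hν q R Ach ych yunc hr₀ hreg q₀ hunc (ht u hu) (A u) (hB u hu)
    (hch u hu) (hres1 u hu) (hres2 u hu) (hfar u hu) (hρQ u hu).1 (hρQ u hu).2 (hal u hu).1 (hal u hu).2 (hsh2 u hu)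
    (hsh3 u hu)
  have hio := fun u (hu : u ∈ t) => inout_of_lmin (m := m) hν hr₀ hr₁ hr₁' hδ₀ hσ0 hσ1 ((norm_nonneg _).trans (ha u hu))
    (hav u hu) hlmin (hl u hu) hin0 hout0
  exact farField_ledger_of_rows hC hT hs hν q R Ach ych yunc hr₀ hû hreg t uref ht hθ0 hm0 hm1 hσ0 hσ1 hθv0 hθv hθ hB ha hav
    (fun u hu => (hrows u hu).1) (fun u hu => (hrows u hu).2) (fun u hu => (hio u hu).1) (fun u hu => (hio u hu).2)
    hd₁ hc₁ hcov₁ hci₁ hd₂ hc₂ hcov₂ hci₂ hU hKU hKrU hg h1 h2 h3 h4 e3 e4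

end

end Summit.AtomisticToContinuum.Crystallization.Theorems.OverbindingBudgetAffineFarFieldLedgerShells
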